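import Mathlib
import Literature.AlgebraicGeometry.Resolution.FullChainGoodTail
import Literature.AlgebraicGeometry.Resolution.CompletedChainDescentPointStep
import Literature.AlgebraicGeometry.Resolution.CompletedChainDescentCurveStep
import Literature.AlgebraicGeometry.Resolution.TotallyPreparedCompletion
import Literature.AlgebraicGeometry.Resolution.VPreparedLabelShear
import Literature.AlgebraicGeometry.Resolution.AxialUnitChainLaw
import Literature.AlgebraicGeometry.Resolution.ExcellentRings
import HarnessLib

/-!
# No infinite chain of `τ = 1` near points over an isolated point: the descent down the completed chain (CONTRACT v3′)

Topic: `Literature/AlgebraicGeometry/Resolution`. V. Cossart, U. Jannsen, S. Saito, *Desingularization: invariants and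
strategy*, LNM 2270 (2020), proof of Thm. 13.7 (pp. 157–158: «we may assume … `R₀` is complete», «choose a totally
prepared label»), Prop. 13.5, Lemmas 12.1–12.4, 13.4, 13.6, Thm. 14.4, Claim 13.8, Thm. 8.24
[cite: CossartJannsenSaito2020, Thm. 13.7]; V. Cossart, O. Piltant, *Resolution of singularities of threefolds in
positive characteristic II*, J. Algebra 321 (2009), Prop. 4.4 (proof, pp. 11–14), Lemma 4.5
[cite: CossartPiltant2008, Prop. 4.4]; H. Matsumura, *Commutative Ring Theory*, §32 p. 256 [cite: Matsumura1987, §32].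

OURS — the RING-LEVEL theorem of the `τ = 1` line for the FULL chain (CONTRACT v3′ `false_of_fullChain_tau_one'`
of the T1 skeleton, binder block of `candidates/F71_T1ring_CONTRACT_v3prime_SIGNATURE_p8b.lean` verbatim; OPTION R of
the INPUTS cell, critic R106/R109/R112/R119): along an infinite chain of three-dimensional regular local G-rings with
the hypotheses listed in the theorem one derives `False`. Architecture (print, CJS Thm. 13.7): per level `n`, in the
completion `R̂_n`, a totally prepared adapted label `x = (ŷ, ι p₁, ι p₂)` with EXACT algebraic slots `p₁, p₂ ∈ R_n` in
the fixed print orientation and a flag `e` recording which slot is the contract's exceptional parameter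
(`span {p_e} = span {u_n}`); the measure `M n = 2·β(x) + [e = 2]` is non-increasing along the one-level steps
(`CompletedChainDescentPointStep.completedChain_descent_pointStep`: shear + `u₁`-chart origin / non-rational point /
`u₂`-chart origin; `CompletedChainDescentCurveStep.completedChain_descent_curveStep`: the `(0,1)` / `(0,2)` curve
blow-ups), strictly except at GOOD steps (`k(x_{n+1}) = k(x_n)` and `(u_{n+1}) = (φ_n u_n)`); an eventually constant
`M` yields a good tail from a point level on, which is CONTRACT v2 `false_of_unitChain_tau_one_rational` re-based
there (`FullChainGoodTail.false_of_goodTail`). Level `0` is totally prepared by `exists_totallyPrepared_adicCompletion`.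
The binders `hc₀ad` (implied by `hδ₀`) and `huP` (implied by `hPsucc_pt`/`hPsucc_cv`) of the frozen contract are not
needed by this route (kept for the interface). AI-written formalization, weaker than expert review. F-71 / T1 are NOT
proved here (T1 consumes this theorem through `CP2008Prop44.T1_of_N2full'`); no summit statement is proved;
resolution of singularities in dimension `≥ 4` / positive characteristic is NOT proved.
-/

noncomputable section

open IsLocalRing MvPolynomial

namespace Literature.AlgebraicGeometry.Resolution

universe u

/-! ## One level of the descent -/

section Frame

variable {R R' : Type u} [CommRing R] [CommRing R'] [IsRegularLocalRing R] [IsRegularLocalRing R']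
  (φ : R →+* R') [IsLocalHom φ] (hφm : (maximalIdeal R).map φ ≤ maximalIdeal R')
  (hdim : ringKrullDim R = 3) (hdim' : ringKrullDim R' = 3)

include hφm hdim hdim' in
/-- **ONE LEVEL of the descent down the completed chain (OURS)** (CJS Thm. 13.7 proof, Prop. 13.5):
from a totally prepared adapted label `x = (ŷ, ι p₁, ι p₂)` of `R̂` (exact algebraic slots, flag `e` with
`span {p_e} = span {u_n}`, a presentation `(y₁, u_n)` of the centre at a curve level) and the v3′ clauses of this
level, a label of `R̂′` of the same kind with `2β′ + [e′] ≤ 2β + [e]`, equality forcing a GOOD step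
(`k(x′) = k(x)` and `(u_{n+1}) = (φ u_n)`): the point level `completedChain_descent_pointStep` or the curve level
`completedChain_descent_curveStep`.
[cite: CossartJannsenSaito2020, Thm. 13.7 (proof), Prop. 13.5, Lemma 13.4, Lemma 13.6, Thm. 14.4]
[cite: CossartPiltant2008, Lemma 4.5] -/
theorem descent_step (hG : IsGRing R) (hG' : IsGRing R')
    {I : Ideal R} {I' : Ideal R'} {μ : ℕ} (hμ : 1 ≤ μ)
    (hIμ : I ≤ maximalIdeal R ^ μ) (hIne : ¬ I ≤ maximalIdeal R ^ (μ + 1))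
    (hIμ' : I' ≤ maximalIdeal R' ^ μ) (hIne' : ¬ I' ≤ maximalIdeal R' ^ (μ + 1))
    (hτ : ∀ c : Fin 3 → R, Ideal.span {c 0, c 1, c 2} = maximalIdeal R → hironakaTauAt c I μ = 1)
    (hτ' : ∀ c' : Fin 3 → R', Ideal.span {c' 0, c' 1, c' 2} = maximalIdeal R' → hironakaTauAt c' I' μ = 1)
    (uN : R) (uN' : R') (isPt isPt' : Prop) (P : Ideal R) (P' : Ideal R')
    (hexc_pt : isPt → (maximalIdeal R).map φ = Ideal.span {uN'})
    (hexc_cv : ¬ isPt → P.map φ = Ideal.span {uN'})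
    (hI : I' = (I.map φ).colon {uN' ^ μ})
    (hpt_cases : isPt → ∀ (c : Fin 3 → R), Ideal.span {c 0, c 1, c 2} = maximalIdeal R →
      (∀ G ∈ initialForms c I μ, ∃ a : ResidueField R, G = C a * X 0 ^ μ) →
      (Function.Surjective (ResidueField.map φ) ∧
        ∃ (a : R) (y' w' : R'), φ (c 0) = φ (c 1) * y' ∧ φ (c 2 - a * c 1) = φ (c 1) * w' ∧
          Ideal.span {y', φ (c 1), w'} = maximalIdeal R') ∨
      (¬ Function.Surjective (ResidueField.map φ) ∧
        ∃ (t : R') (Q : Polynomial R) (y' : R'),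
          φ (c 0) = φ (c 1) * y' ∧ φ (c 2) = φ (c 1) * t ∧ Q.Monic ∧
          2 ≤ (Q.map (residue R)).natDegree ∧ Irreducible (Q.map (residue R)) ∧
          (∀ G : Polynomial R, Polynomial.eval₂ φ t G ∈ maximalIdeal R' ↔
            Q.map (residue R) ∣ G.map (residue R)) ∧
          (∀ r : ResidueField R', ∃ G : Polynomial R, residue R' (Polynomial.eval₂ φ t G) = r) ∧
          Ideal.span {y', φ (c 1), Polynomial.eval₂ φ t Q} = maximalIdeal R') ∨
      (Function.Surjective (ResidueField.map φ) ∧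
        ∃ (y' v' : R'), φ (c 0) = φ (c 2) * y' ∧ φ (c 1) = φ (c 2) * v' ∧
          Ideal.span {y', v', φ (c 2)} = maximalIdeal R'))
    (hIP : ¬ isPt → I ≤ P ^ μ)
    (hcurve : ¬ isPt → ∀ (y v w : R), Ideal.span {v} = Ideal.span {uN} → Ideal.span {y, v} = P →
      Ideal.span {y, v, w} = maximalIdeal R →
      (∀ G ∈ initialForms ![y, v, w] I μ, ∃ a : ResidueField R, G = C a * X 0 ^ μ) →
      Function.Surjective (ResidueField.map φ) ∧
      ∃ y' : R', φ y = φ v * y' ∧ Ideal.span {y', φ v, φ w} = maximalIdeal R')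
    (hqis : ∀ (𝔮 : Ideal R) [𝔮.IsPrime], 𝔮 ≠ maximalIdeal R → (isPt ∨ 𝔮 ≠ P) →
      ¬ I.map (algebraMap R (Localization.AtPrime 𝔮)) ≤ maximalIdeal (Localization.AtPrime 𝔮) ^ μ)
    (hqis' : ∀ (𝔮 : Ideal R') [𝔮.IsPrime], 𝔮 ≠ maximalIdeal R' → (isPt' ∨ 𝔮 ≠ P') →
      ¬ I'.map (algebraMap R' (Localization.AtPrime 𝔮)) ≤ maximalIdeal (Localization.AtPrime 𝔮) ^ μ)
    (hPsucc_pt : isPt → ¬ isPt' → ∀ (y w : R) (y' : R'), Ideal.span {y, uN, w} = maximalIdeal R →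
      (∀ G ∈ initialForms ![y, uN, w] I μ, ∃ a : ResidueField R, G = C a * X 0 ^ μ) →
      φ y = uN' * y' → Ideal.span {y', uN'} = P')
    (hPsucc_cv : ¬ isPt → ¬ isPt' → ∀ (y v w : R) (y' : R'), Ideal.span {v} = Ideal.span {uN} →
      Ideal.span {y, v} = P → Ideal.span {y, v, w} = maximalIdeal R →
      (∀ G ∈ initialForms ![y, v, w] I μ, ∃ a : ResidueField R, G = C a * X 0 ^ μ) →
      φ y = φ v * y' → uN' ∈ P' ∧ ∃ β ∈ maximalIdeal R, Ideal.span {y' + φ β, uN'} = P')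
    [IsRegularLocalRing (AdicCompletion (maximalIdeal R) R)] [IsRegularLocalRing (AdicCompletion (maximalIdeal R') R')]
    -- the descent datum at this level
    (x : Fin 3 → AdicCompletion (maximalIdeal R) R) (p₁ p₂ : R) (e : Bool)
    (hx1 : x 1 = algebraMap R (AdicCompletion (maximalIdeal R) R) p₁)
    (hx2 : x 2 = algebraMap R (AdicCompletion (maximalIdeal R) R) p₂)
    (hgenx : Ideal.span {x 0, x 1, x 2} = maximalIdeal (AdicCompletion (maximalIdeal R) R))
    (hprep : ∀ B, PreparedUpTo x (I.map (algebraMap R (AdicCompletion (maximalIdeal R) R))) μ B)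
    (hne : (pts x (I.map (algebraMap R (AdicCompletion (maximalIdeal R) R))) μ).Nonempty)
    (hδ : μ.factorial < deltaS x (I.map (algebraMap R (AdicCompletion (maximalIdeal R) R))) μ)
    (hflag : Ideal.span {if e then p₂ else p₁} = Ideal.span {uN})
    (hpres : ¬ isPt → ∃ y₁ ∈ maximalIdeal R, Ideal.span {y₁, uN} = P) :
    ∃ (x' : Fin 3 → AdicCompletion (maximalIdeal R') R') (p₁' p₂' : R') (e' : Bool),
      x' 1 = algebraMap R' (AdicCompletion (maximalIdeal R') R') p₁' ∧
      x' 2 = algebraMap R' (AdicCompletion (maximalIdeal R') R') p₂' ∧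
      Ideal.span {x' 0, x' 1, x' 2} = maximalIdeal (AdicCompletion (maximalIdeal R') R') ∧
      (∀ B, PreparedUpTo x' (I'.map (algebraMap R' (AdicCompletion (maximalIdeal R') R'))) μ B) ∧
      (pts x' (I'.map (algebraMap R' (AdicCompletion (maximalIdeal R') R'))) μ).Nonempty ∧
      μ.factorial < deltaS x' (I'.map (algebraMap R' (AdicCompletion (maximalIdeal R') R'))) μ ∧
      Ideal.span {if e' then p₂' else p₁'} = Ideal.span {uN'} ∧
      (¬ isPt' → ∃ y₁ ∈ maximalIdeal R', Ideal.span {y₁, uN'} = P') ∧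
      2 * betaS x' (I'.map (algebraMap R' (AdicCompletion (maximalIdeal R') R'))) μ + (if e' then 1 else 0) ≤
        2 * betaS x (I.map (algebraMap R (AdicCompletion (maximalIdeal R) R))) μ + (if e then 1 else 0) ∧
      (2 * betaS x' (I'.map (algebraMap R' (AdicCompletion (maximalIdeal R') R'))) μ + (if e' then 1 else 0) =
          2 * betaS x (I.map (algebraMap R (AdicCompletion (maximalIdeal R) R))) μ + (if e then 1 else 0) →
        Function.Surjective (ResidueField.map φ) ∧ Ideal.span {uN'} = Ideal.span {φ uN}) := by
  by_cases hn : isPt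
  · exact completedChain_descent_pointStep φ hφm hdim hdim' hG hG' hIμ hIne hIμ' hIne' hτ' uN uN' isPt' P' (hexc_pt hn) hI
      (hpt_cases hn) (fun 𝔮 _ h𝔮 => hqis 𝔮 h𝔮 (Or.inl hn)) hqis' (hPsucc_pt hn) x p₁ p₂ e hx1 hx2 hgenx hprep
      hne hδ hflag
  · exact completedChain_descent_curveStep φ hφm hdim hdim' hμ hIμ hIne hIμ' hIne' hτ hτ' uN uN' isPt' P P' (hexc_cv hn) hI
      (hIP hn) (hcurve hn) (hPsucc_cv hn) x p₁ p₂ e hx1 hx2 hgenx hprep hne hδ hflag (hpres hn)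

end Frame

/-! ## The theorem (CONTRACT v3′, binder block 4da8544dee9e0b4d verbatim) -/

/-- A non-increasing `ℕ`-valued sequence is eventually constant. [cite: Matsumura1987, §1 (p. 2)] -/
theorem exists_forall_le_eq_of_antitone_nat (M : ℕ → ℕ) (hM : ∀ n, M (n + 1) ≤ M n) :
    ∃ n₁, ∀ n, n₁ ≤ n → M (n + 1) = M n := by
  classical
  -- the minimum value of `M` is attained at some `n₁`; after it `M` is constant
  obtain ⟨n₁, hn₁⟩ : ∃ n₁, M n₁ = sInf (Set.range M) := Nat.sInf_mem (Set.range_nonempty M)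
  refine ⟨n₁, fun n hn => ?_⟩
  have h1 : M (n + 1) ≤ M n := hM n
  have h2 : M n ≤ M n₁ := antitone_nat_of_succ_le hM hn
  have h3 : M n₁ ≤ M (n + 1) := by rw [hn₁]; exact Nat.sInf_le ⟨n + 1, rfl⟩
  omega

/-- **CONTRACT v3′ (OURS). No infinite chain of `τ = 1` near points over an isolated point of `{ord ≥ μ}` of an excellent
regular threefold — ring form, FULL chain.** Data: regular local rings `R_n` of dimension `3`, local maps `φ_n`, ideals
`I_n` (order exactly `μ`, `τ = 1` in every regular system, G-rings), the exceptional parameters `u_n`, weak transforms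
`I_{n+1} = (I_n R_{n+1} : u_{n+1}^μ)`; POINT steps: for EVERY adapted label the TRICHOTOMY of the near point in the
label's own charts; CURVE steps: centre `P_n ∋ u_n`, `I_n ⊆ P_n^μ`, chart for every adapted presentation; quasi-isolation
at every level; the next centres; infinitely many point steps; level `0` a point step with an adapted label. Conclusion:
`False`. See the module docstring for the architecture of the proof.
[cite: CossartJannsenSaito2020, Thm. 13.7, Lemma 13.4, Lemma 13.6, Claim 13.8, Thm. 8.24] [cite: CossartPiltant2008, Prop. 4.4 (proof, pp. 11–14), Lemma 4.5]
[cite: Matsumura1987, §32 p. 256] -/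
theorem false_of_fullChain_tau_one'
    (Rn : ℕ → Type u) [∀ n, CommRing (Rn n)] [∀ n, IsRegularLocalRing (Rn n)]
    (hdim : ∀ n, ringKrullDim (Rn n) = 3) (φ : ∀ n, Rn n →+* Rn (n + 1)) [∀ n, IsLocalHom (φ n)]
    (I : ∀ n, Ideal (Rn n)) {μ : ℕ} (hμ : 1 ≤ μ) (u : ∀ n, Rn n)
    (pt : ℕ → Prop) (hpt0 : pt 0)
    -- excellence at every level; level `0`: an adapted label `(c₀ 0, u 0, c₀ 2)` with `L < δs`
    (hG : ∀ n, IsGRing (Rn n))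
    (c₀ : Fin 3 → Rn 0) (hc₀ : Ideal.span {c₀ 0, c₀ 1, c₀ 2} = maximalIdeal (Rn 0)) (hc₀u : c₀ 1 = u 0)
    (hc₀ad : ∀ G ∈ initialForms c₀ (I 0) μ, ∃ a : ResidueField (Rn 0), G = C a * X 0 ^ μ)
    (hδ₀ : μ.factorial < deltaS c₀ (I 0) μ)
    -- every level: near, order exactly `μ`, `τ = 1` in every regular system of parameters
    (hIμ : ∀ n, I n ≤ maximalIdeal (Rn n) ^ μ) (hIne : ∀ n, ¬ I n ≤ maximalIdeal (Rn n) ^ (μ + 1))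
    (hτ : ∀ n (c : Fin 3 → Rn n), Ideal.span {c 0, c 1, c 2} = maximalIdeal (Rn n) →
      hironakaTauAt c (I n) μ = 1)
    -- the exceptional parameter (label-free) and the weak transform as the colon by its `μ`-th power
    (P : ∀ n, Ideal (Rn n))
    (hexc_pt : ∀ n, pt n → (maximalIdeal (Rn n)).map (φ n) = Ideal.span {u (n + 1)})
    (hexc_cv : ∀ n, ¬ pt n → (P n).map (φ n) = Ideal.span {u (n + 1)})
    (hI : ∀ n, I (n + 1) = ((I n).map (φ n)).colon {u (n + 1) ^ μ})
    -- POINT steps: for EVERY adapted label `c` (any orientation), the TRICHOTOMY of the near point in `c`'s own charts (σ/σ′):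
    -- (i)/(ii) rational point `(1 : ā)` of the `c 1`-chart · (iii) non-rational point of the `c 1`-chart · (i′) the origin of the `c 2`-chart
    (hpt_cases : ∀ n, pt n → ∀ (c : Fin 3 → Rn n), Ideal.span {c 0, c 1, c 2} = maximalIdeal (Rn n) →
      (∀ G ∈ initialForms c (I n) μ, ∃ a : ResidueField (Rn n), G = C a * X 0 ^ μ) →
      (Function.Surjective (ResidueField.map (φ n)) ∧
        ∃ (a : Rn n) (y' w' : Rn (n + 1)), φ n (c 0) = φ n (c 1) * y' ∧ φ n (c 2 - a * c 1) = φ n (c 1) * w' ∧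
          Ideal.span {y', φ n (c 1), w'} = maximalIdeal (Rn (n + 1))) ∨
      (¬ Function.Surjective (ResidueField.map (φ n)) ∧
        ∃ (t : Rn (n + 1)) (Q : Polynomial (Rn n)) (y' : Rn (n + 1)),
          φ n (c 0) = φ n (c 1) * y' ∧ φ n (c 2) = φ n (c 1) * t ∧ Q.Monic ∧
          2 ≤ (Q.map (residue (Rn n))).natDegree ∧ Irreducible (Q.map (residue (Rn n))) ∧
          (∀ G : Polynomial (Rn n), Polynomial.eval₂ (φ n) t G ∈ maximalIdeal (Rn (n + 1)) ↔
            Q.map (residue (Rn n)) ∣ G.map (residue (Rn n))) ∧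
          (∀ r : ResidueField (Rn (n + 1)), ∃ G : Polynomial (Rn n), residue (Rn (n + 1)) (Polynomial.eval₂ (φ n) t G) = r) ∧
          Ideal.span {y', φ n (c 1), Polynomial.eval₂ (φ n) t Q} = maximalIdeal (Rn (n + 1))) ∨
      (Function.Surjective (ResidueField.map (φ n)) ∧
        ∃ (y' v' : Rn (n + 1)), φ n (c 0) = φ n (c 2) * y' ∧ φ n (c 1) = φ n (c 2) * v' ∧
          Ideal.span {y', v', φ n (c 2)} = maximalIdeal (Rn (n + 1))))
    -- CURVE steps: centre prime `P n ∋ u n`, permissibility, chart for EVERY adapted presentation `(y, v)`, `v` ~ `u_n`, of the centre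
    (hIP : ∀ n, ¬ pt n → I n ≤ P n ^ μ) (huP : ∀ n, ¬ pt n → u n ∈ P n)
    (hcurve : ∀ n, ¬ pt n → ∀ (y v w : Rn n), Ideal.span {v} = Ideal.span {u n} → Ideal.span {y, v} = P n →
      Ideal.span {y, v, w} = maximalIdeal (Rn n) →
      (∀ G ∈ initialForms ![y, v, w] (I n) μ, ∃ a : ResidueField (Rn n), G = C a * X 0 ^ μ) →
      Function.Surjective (ResidueField.map (φ n)) ∧
      ∃ y' : Rn (n + 1), φ n y = φ n v * y' ∧
        Ideal.span {y', φ n v, φ n w} = maximalIdeal (Rn (n + 1)))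
    -- quasi-isolation at EVERY level, relative to the centre (point steps: `pt n ∨ …`)
    (hqis : ∀ n (𝔮 : Ideal (Rn n)) [𝔮.IsPrime], 𝔮 ≠ maximalIdeal (Rn n) → (pt n ∨ 𝔮 ≠ P n) →
      ¬ (I n).map (algebraMap (Rn n) (Localization.AtPrime 𝔮)) ≤ maximalIdeal (Localization.AtPrime 𝔮) ^ μ)
    -- after a POINT step the next centre (if a curve) is the line `(y′, u_{n+1})`, in whichever chart `x_{n+1}` lies
    (hPsucc_pt : ∀ n, pt n → ¬ pt (n + 1) → ∀ (y w : Rn n) (y' : Rn (n + 1)),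
      Ideal.span {y, u n, w} = maximalIdeal (Rn n) →
      (∀ G ∈ initialForms ![y, u n, w] (I n) μ, ∃ a : ResidueField (Rn n), G = C a * X 0 ^ μ) →
      φ n y = u (n + 1) * y' → Ideal.span {y', u (n + 1)} = P (n + 1))
    -- after a CURVE step the next centre (if a curve) is the strict transform up to a correction `β ∈ 𝔪_n` (κ″)
    (hPsucc_cv : ∀ n, ¬ pt n → ¬ pt (n + 1) → ∀ (y v w : Rn n) (y' : Rn (n + 1)), Ideal.span {v} = Ideal.span {u n} →
      Ideal.span {y, v} = P n → Ideal.span {y, v, w} = maximalIdeal (Rn n) →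
      (∀ G ∈ initialForms ![y, v, w] (I n) μ, ∃ a : ResidueField (Rn n), G = C a * X 0 ^ μ) →
      φ n y = φ n v * y' →
      u (n + 1) ∈ P (n + 1) ∧ ∃ β ∈ maximalIdeal (Rn n), Ideal.span {y' + φ n β, u (n + 1)} = P (n + 1))
    -- infinitely many point steps (T1-α)
    (hinf : ∀ n₀, ∃ n, n₀ ≤ n ∧ pt n) :
    False := by
  classical
  have _hc₀ad := hc₀ad -- implied by `hδ₀`; kept in the frozen contract, not needed by this route
  have _huP := huP -- implied by `hPsucc_pt` / `hPsucc_cv`; idem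
  -- the completed rings `R̂_n` are regular; the maps `φ_n` are local
  haveI hreg : ∀ n, IsRegularLocalRing (AdicCompletion (maximalIdeal (Rn n)) (Rn n)) := fun n =>
    isRegularLocalRing_adicCompletion (Rn n)
  have hφm : ∀ n, (maximalIdeal (Rn n)).map (φ n) ≤ maximalIdeal (Rn (n + 1)) := fun n =>
    Ideal.map_le_iff_le_comap.mpr fun x hx => by
      rw [Ideal.mem_comap, mem_maximalIdeal, mem_nonunits_iff]
      exact fun h => ((mem_maximalIdeal _).mp hx) (isUnit_of_map_unit (φ n) x h)
  -- the invariant of a descent datum `(x, p₁, p₂, e)` at level `n`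
  obtain ⟨Inv, hInvdef⟩ : ∃ Inv : ∀ n, (Fin 3 → AdicCompletion (maximalIdeal (Rn n)) (Rn n)) → Rn n → Rn n → Bool → Prop,
      ∀ n x p₁ p₂ e, Inv n x p₁ p₂ e ↔
        (x 1 = algebraMap (Rn n) (AdicCompletion (maximalIdeal (Rn n)) (Rn n)) p₁ ∧
         x 2 = algebraMap (Rn n) (AdicCompletion (maximalIdeal (Rn n)) (Rn n)) p₂ ∧
         Ideal.span {x 0, x 1, x 2} = maximalIdeal (AdicCompletion (maximalIdeal (Rn n)) (Rn n)) ∧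
         (∀ B, PreparedUpTo x ((I n).map (algebraMap (Rn n) (AdicCompletion (maximalIdeal (Rn n)) (Rn n)))) μ B) ∧
         (pts x ((I n).map (algebraMap (Rn n) (AdicCompletion (maximalIdeal (Rn n)) (Rn n)))) μ).Nonempty ∧
         μ.factorial < deltaS x ((I n).map (algebraMap (Rn n) (AdicCompletion (maximalIdeal (Rn n)) (Rn n)))) μ ∧
         Ideal.span {if e then p₂ else p₁} = Ideal.span {u n} ∧
         (¬ pt n → ∃ y₁ ∈ maximalIdeal (Rn n), Ideal.span {y₁, u n} = P n)) :=
    ⟨_, fun _ _ _ _ _ => Iff.rfl⟩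
  -- the states and their measure `M = 2β + [e = 2]`
  let St : ℕ → Type u := fun n =>
    {s : (Fin 3 → AdicCompletion (maximalIdeal (Rn n)) (Rn n)) × Rn n × Rn n × Bool // Inv n s.1 s.2.1 s.2.2.1 s.2.2.2}
  let M : ∀ n, St n → ℕ := fun n s =>
    2 * betaS s.1.1 ((I n).map (algebraMap (Rn n) (AdicCompletion (maximalIdeal (Rn n)) (Rn n)))) μ +
      (if s.1.2.2.2 then 1 else 0)
  -- ONE STEP of the descent (stub S-step)
  have hstep : ∀ n (s : St n), ∃ s' : St (n + 1), M (n + 1) s' ≤ M n s ∧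
      (M (n + 1) s' = M n s →
        Function.Surjective (ResidueField.map (φ n)) ∧ Ideal.span {u (n + 1)} = Ideal.span {φ n (u n)}) := by
    intro n s
    obtain ⟨hx1, hx2, hgenx, hprep, hne, hδ, hflag, hpres⟩ := (hInvdef n _ _ _ _).mp s.2
    obtain ⟨x', p₁', p₂', e', hx1', hx2', hgen', hprep', hne', hδ', hflag', hpres', hle, hgoodimp⟩ :=
      descent_step (φ n) (hφm n) (hdim n) (hdim (n + 1)) (hG n) (hG (n + 1)) hμ (hIμ n) (hIne n)
        (hIμ (n + 1)) (hIne (n + 1)) (hτ n) (hτ (n + 1)) (u n) (u (n + 1)) (pt n) (pt (n + 1)) (P n) (P (n + 1))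
        (hexc_pt n) (hexc_cv n) (hI n) (hpt_cases n) (hIP n) (hcurve n) (hqis n) (hqis (n + 1)) (hPsucc_pt n)
        (hPsucc_cv n) s.1.1 s.1.2.1 s.1.2.2.1 s.1.2.2.2 hx1 hx2 hgenx hprep hne hδ hflag hpres
    exact ⟨⟨(x', p₁', p₂', e'), (hInvdef (n + 1) x' p₁' p₂' e').mpr ⟨hx1', hx2', hgen', hprep', hne', hδ', hflag', hpres'⟩⟩,
      hle, hgoodimp⟩
  -- LEVEL 0: total preparation in `R̂₀` (B4) of the adapted label `c₀`
  have hisol0 : ∀ (𝔮 : Ideal (Rn 0)) [𝔮.IsPrime], 𝔮 ≠ maximalIdeal (Rn 0) →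
      ¬ (I 0).map (algebraMap (Rn 0) (Localization.AtPrime 𝔮)) ≤ maximalIdeal (Localization.AtPrime 𝔮) ^ μ :=
    fun 𝔮 _ h𝔮 => hqis 0 𝔮 h𝔮 (Or.inl hpt0)
  have hgenι : Ideal.span {algebraMap (Rn 0) (AdicCompletion (maximalIdeal (Rn 0)) (Rn 0)) (c₀ 0),
      algebraMap (Rn 0) (AdicCompletion (maximalIdeal (Rn 0)) (Rn 0)) (c₀ 1),
      algebraMap (Rn 0) (AdicCompletion (maximalIdeal (Rn 0)) (Rn 0)) (c₀ 2)} =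
      maximalIdeal (AdicCompletion (maximalIdeal (Rn 0)) (Rn 0)) := by
    have h := congrArg (Ideal.map (algebraMap (Rn 0) (AdicCompletion (maximalIdeal (Rn 0)) (Rn 0)))) hc₀
    rw [Ideal.map_span, Set.image_insert_eq, Set.image_insert_eq, Set.image_singleton,
      ← AdicCompletion.maximalIdeal_eq_map] at h
    exact h
  obtain ⟨yh, -, -, hgen0, hne0, hδ0, hprep0, -⟩ := exists_totallyPrepared_adicCompletion (hG 0) c₀ hc₀ (hdim 0)
    (hIμ 0) hδ₀ hisol0 (algebraMap (Rn 0) (AdicCompletion (maximalIdeal (Rn 0)) (Rn 0)) (c₀ 2)) hgenι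
  have hInv0 : Inv 0 (![yh, algebraMap (Rn 0) (AdicCompletion (maximalIdeal (Rn 0)) (Rn 0)) (c₀ 1),
      algebraMap (Rn 0) (AdicCompletion (maximalIdeal (Rn 0)) (Rn 0)) (c₀ 2)]) (c₀ 1) (c₀ 2) false :=
    (hInvdef 0 _ _ _ _).mpr ⟨rfl, rfl, hgen0, hprep0, hne0, hδ0, by simp [hc₀u], fun h => absurd hpt0 h⟩
  -- the descent sequence and its measure
  choose next hnext using hstep
  let sq : ∀ n, St n := fun n =>
    Nat.rec (motive := St) ⟨(_, c₀ 1, c₀ 2, false), hInv0⟩ (fun n ih => next n ih) n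
  have hsq : ∀ n, sq (n + 1) = next n (sq n) := fun n => rfl
  obtain ⟨n₁, hn₁⟩ := exists_forall_le_eq_of_antitone_nat (fun n => M n (sq n)) fun n => by
    show M (n + 1) (sq (n + 1)) ≤ M n (sq n)
    rw [hsq]; exact (hnext n (sq n)).1
  -- a point level in the good tail
  obtain ⟨n₀, hn₀, hptn₀⟩ := hinf n₁
  have hgood : ∀ n, n₀ ≤ n →
      Function.Surjective (ResidueField.map (φ n)) ∧ Ideal.span {u (n + 1)} = Ideal.span {φ n (u n)} :=
    fun n hn => (hnext n (sq n)).2 (by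
      have h : M (n + 1) (sq (n + 1)) = M n (sq n) := hn₁ n (hn₀.trans hn)
      rw [hsq] at h
      exact h)
  -- the algebraic adapted label at `n₀` under the datum of `sq n₀`, the flagged slot in the middle
  obtain ⟨hx1, hx2, hgenx, -, -, hδ, hflag, -⟩ := (hInvdef n₀ _ _ _ _).mp (sq n₀).2
  obtain ⟨l, -, hl, hlad⟩ := exists_adapted_label_of_completion (hdim n₀) (hIμ n₀) (sq n₀).1.1 (sq n₀).1.2.1
    (sq n₀).1.2.2.1 hx1 hx2 hgenx hδ
  obtain ⟨c, hc, hcu, hcad⟩ : ∃ c : Fin 3 → Rn n₀, Ideal.span {c 0, c 1, c 2} = maximalIdeal (Rn n₀) ∧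
      Ideal.span {c 1} = Ideal.span {u n₀} ∧
      ∀ G ∈ initialForms c (I n₀) μ, ∃ a : ResidueField (Rn n₀), G = C a * X 0 ^ μ := by
    cases he : (sq n₀).1.2.2.2 with
    | false =>
      rw [he] at hflag
      exact ⟨![l, (sq n₀).1.2.1, (sq n₀).1.2.2.1], hl, by simpa using hflag, hlad⟩
    | true =>
      rw [he] at hflag
      have hl' : Ideal.span {l, (sq n₀).1.2.2.1, (sq n₀).1.2.1} = maximalIdeal (Rn n₀) := by
        have hset : ({l, (sq n₀).1.2.2.1, (sq n₀).1.2.1} : Set (Rn n₀)) = {l, (sq n₀).1.2.1, (sq n₀).1.2.2.1} := by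
          rw [Set.pair_comm ((sq n₀).1.2.2.1) ((sq n₀).1.2.1)]
        exact (congrArg Ideal.span hset).trans hl
      refine ⟨![l, (sq n₀).1.2.2.1, (sq n₀).1.2.1], hl', by simpa using hflag, ?_⟩
      exact forall_initialForms_of_eq_zero (![l, (sq n₀).1.2.1, (sq n₀).1.2.2.1]) (hdim n₀) (hIμ n₀)
        (![l, (sq n₀).1.2.2.1, (sq n₀).1.2.1]) hl hl' rfl hlad
  -- CONTRACT v2 on the re-based tail (S-tail)
  exact false_of_goodTail Rn hdim φ I hμ u pt hG hIμ hIne hτ P hexc_pt hI hpt_cases hIP hcurve hqis hPsucc_pt hPsucc_cv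
    n₀ hptn₀ c hc hcu hcad hgood

end Literature.AlgebraicGeometry.Resolution

end
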